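import Literature.AlgebraicGeometry.ShimuraVarieties.UnitaryBallH1RestrictionToSpecialCurves
import Literature.AlgebraicGeometry.ShimuraVarieties.UnitaryAnisotropicLineFrame
import Literature.NumberTheory.Automorphic.UnitaryGroupFrameEmbedding
import HarnessLib

/-!
# The frame of a totally positive line `W ⊆ V` of a compact ball-quotient datum and the algebraic clauses (`gram`,
# `orthogonal`, `group`) of a compatible special source `Sh(U(W^⊥)) → Sh(U(V))` ([Liu 2021] Thm. 4.15 proof l. 2207;
# [BMM16] Part 2 §3.1) — banked GS-7 junction (cell `hodgecm-mathlib`, memo `GS-PROGRAMME.md` §9 A.13)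

Topic `AlgebraicGeometry/ShimuraVarieties`; namespace `Literature.AlgebraicGeometry.ShimuraVarieties.UnitaryBallUniformisationDatum`.
THEOREMS ONLY (no `def`, no named fact, no instance, no `sorry`; `--supports stmt-HodgeConjecture-24832`).

SETTING.  `D : UnitaryBallUniformisationDatum 2 X` (★ `UnitaryBallQuotientDatum.lean`: CM subfield `D.E ⊆ ℂ`, `τ₁ = D.E.subtype`,
`σ = conjRingHom D.E`, anisotropic hermitian `D.H` on `V = D.E³` of signature `(2,1)` at `τ₁`), a FRAME `B : GL (Fin 3) D.E` with
`ᵗσ(B)·H·B = J⋆ ⊕ᶠ J⊥` (`formCongr σ B D.H = finSum 2 1 Jstar Jperp`), and the complex `3 × 2` embedding matrix of its first two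
columns, `M = τ₁(B·(e₁|e₂)) = ((B : Matrix).submatrix id Fin.castSucc).map D.E.subtype` (★ F3 `UnitaryAnisotropicLineFrame`'s shape;
`submatrix_castSucc_mulVec`: it is ★ (G2) `UnitaryGroupFrameEmbedding`'s `x ↦ B(x ⊕ 0)` on vectors).  The consumer is ★
`IsCompatibleSpecialSource D W D₁ φ M` (`UnitaryBallH1RestrictionToSpecialCurves.lean` :245, the hypothesis structure of the named fact
III-8′ `MR92Prop6Source`), whose FOUR clauses a GS-7 source must meet:
* `gram` — `conjTranspose_embMatrix_mul_map_mul_embMatrix`: `Mᴴ·H^{τ₁}·M = J⋆^{τ₁}` (one line over ★ F3), whence the clause for ANY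
  rank-2 datum `D₁` whose complex Gram matrix is `J⋆^{τ₁}` (`gram_of_map_eq`: the ONE junction condition
  `D₁.H.map D₁.E.subtype = Jstar.map D.E.subtype` — the GS-4 record must carry the same CM subfield and `H₁ = J⋆`);
* `orthogonal` — `hermForm_map_span_lastCol_embMatrix_mulVec` for the line `W = D.E ∙ (B e₃)` (= `V⋆^⊥`);
* `group` — `map_conj_finSum_one_mul_embMatrix`: for EVERY `γ₁ ∈ M₂(D.E)` the conjugate `γ = B·(γ₁ ⊕ᶠ 1)·B⁻¹` satisfies the MATRIX
  identity `γ^{τ₁}·M = M·γ₁^{τ₁}` (vector form ★ (G2) `conj_finSum_one_right_mulVec_frameEmb_zero`; the clause's membership `γ ∈ D.Γ`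
  is the consumer's choice of `Γ₁`, cf. ★ `UnitaryGroupFrameEmbeddingLevels`);
* `unif_comp` — NOT here: it is the analytic/cited content ([Milne05] Thm. 13.6 / [Del79] 2.2.6) of the GS programme.
Finally `exists_frame_of_isTotallyPositive_line`: for every totally positive definite `D.E`-LINE `W` (the `W` of ★ `MR92Prop6Source`:
`IsTotallyPositive σ D.H W ∧ finrank W = 1`) such a frame EXISTS with `W = D.E ∙ (B e₃)` and `J⊥₀₀` totally positive (★ F3
`exists_frame_formCongr_eq_finSum_of_isTotallyPositive_of_isHermitian` at the datum) — so `(B, J⋆, M)` and clauses (1)–(3) come from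
`W` alone.  HC_CM is proved only modulo the 7 printed citations until rung 0 closes; nothing here is in any crux's registered cone
(banked capital for GS-7, books 0).

## References
* [Liu2021] Y. Liu, Camb. J. Math. 9 (2021), proof of Thm. 4.15, l. 2207 and l. 2212 (the special curves `Sh(G⋆, h⋆) → Sh(G, h)`).
* [BergeronMillsonMoeglin2016Balls] N. Bergeron, J. Millson, C. Moeglin, Acta Math. 216 (2016), Part 2 §1.1, §3.1 (sub-ball quotients).
* [Milne2005ShimuraVarieties] J. S. Milne, *Introduction to Shimura varieties* (2005), Def. 12.5 / Rem. 12.6 p. 113, Thm. 13.6.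
* [Kudla1984] S. Kudla, *Seesaw dual reductive pairs* (1984), §1 (frames of orthogonal direct sums).
-/

set_option autoImplicit false

noncomputable section

open Matrix NumberField
open Literature.NumberTheory.Automorphic
open Literature.NumberTheory.Automorphic.UnitaryGroup (finSum conj_finSum_one_right_mulVec_frameEmb_zero)

namespace Literature.AlgebraicGeometry.ShimuraVarieties

/-! ### §0 Column shape = vector shape -/

section ColumnShape

variable {S : Type*} [CommRing S] {N₁ : ℕ}

/-- `(B·(e₁|…|e_{N₁}))·x = B·(x ⊕ 0)`: ★ F3's column shape `B.submatrix id Fin.castSucc` of the frame embedding is ★ (G2)'s vector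
shape `x ↦ B(x ⊕ 0)` (`Fin.castSucc = Fin.castAdd 1`). [cite: Kudla1984, §1] -/
theorem submatrix_castSucc_mulVec (B : Matrix (Fin (N₁ + 1)) (Fin (N₁ + 1)) S) (x : Fin N₁ → S) :
    B.submatrix id Fin.castSucc *ᵥ x = B *ᵥ Fin.append x (0 : Fin 1 → S) := by
  funext i
  simp only [Matrix.mulVec, dotProduct, Matrix.submatrix_apply, id, Fin.sum_univ_add, Fin.append_right,
    Pi.zero_apply, mul_zero, Finset.sum_const_zero, add_zero]
  refine Finset.sum_congr rfl fun j _ => ?_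
  rw [show Fin.castSucc j = Fin.castAdd 1 j from rfl, Fin.append_left]

end ColumnShape

namespace UnitaryBallUniformisationDatum

open UnitaryBallQuotientDatum

variable {X : Literature.AlgebraicGeometry.Motives.SchemeOver ℂ} (D : UnitaryBallUniformisationDatum 2 X)
variable (B : GL (Fin 3) D.E) (Jstar : Matrix (Fin 2) (Fin 2) D.E) (Jperp : Matrix (Fin 1) (Fin 1) D.E)

/-! ### §1 `gram` -/

/-- **`gram` in frame currency**: `Mᴴ · H^{τ₁} · M = J⋆^{τ₁}` for `M = τ₁(B·(e₁|e₂))` and a frame `ᵗσ(B)·H·B = J⋆ ⊕ᶠ J⊥`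
(★ F3 `conjTranspose_mul_map_mul_eq_map_of_formCongr_eq_finSum` at `τ₁ = D.E.subtype`, `σ = conjRingHom D.E`).
[cite: BergeronMillsonMoeglin2016Balls, Part 2 §3.1] [cite: Liu2021, proof of Thm. 4.15 l. 2207] -/
theorem conjTranspose_embMatrix_mul_map_mul_embMatrix (hB : formCongr (conjRingHom D.E) B D.H = finSum 2 1 Jstar Jperp) :
    (((B : Matrix (Fin 3) (Fin 3) D.E).submatrix id Fin.castSucc).map D.E.subtype).conjTranspose * D.H.map D.E.subtype *
        ((B : Matrix (Fin 3) (Fin 3) D.E).submatrix id Fin.castSucc).map D.E.subtype = Jstar.map D.E.subtype :=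
  conjTranspose_mul_map_mul_eq_map_of_formCongr_eq_finSum (σ := conjRingHom D.E) D.E.subtype
    (embedding_conjRingHom D.E D.E.subtype) hB

/-- **The `gram` CLAUSE of `IsCompatibleSpecialSource`** for any rank-2 datum `D₁` whose complex Gram matrix is `J⋆^{τ₁}` — the ONE
junction condition on the special source (same CM subfield of `ℂ`, `H₁ = J⋆` up to `map subtype`).
[cite: BergeronMillsonMoeglin2016Balls, Part 2 §3.1] [cite: Liu2021, proof of Thm. 4.15 l. 2207] -/
theorem gram_of_map_eq (hB : formCongr (conjRingHom D.E) B D.H = finSum 2 1 Jstar Jperp)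
    {Y : Literature.AlgebraicGeometry.Motives.SchemeOver ℂ} (D₁ : UnitaryBallUniformisationDatum 1 Y)
    (hH₁ : D₁.H.map D₁.E.subtype = Jstar.map D.E.subtype) :
    (((B : Matrix (Fin 3) (Fin 3) D.E).submatrix id Fin.castSucc).map D.E.subtype).conjTranspose * D.H.map D.E.subtype *
        ((B : Matrix (Fin 3) (Fin 3) D.E).submatrix id Fin.castSucc).map D.E.subtype = D₁.H.map D₁.E.subtype := by
  rw [hH₁]
  exact D.conjTranspose_embMatrix_mul_map_mul_embMatrix B Jstar Jperp hB

/-! ### §2 `orthogonal` for the line `W = D.E ∙ (B e₃)` -/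

/-- The last column of the frame is `H`-orthogonal to the first two (the off-diagonal block of `J⋆ ⊕ᶠ J⊥` vanishes).
[cite: BergeronMillsonMoeglin2016Balls, Part 2 §3.1] -/
theorem hermForm_lastCol_castSuccCol_eq_zero (hB : formCongr (conjRingHom D.E) B D.H = finSum 2 1 Jstar Jperp) (j : Fin 2) :
    Literature.AlgebraicGeometry.ShimuraVarieties.hermForm (conjRingHom D.E) D.H
      (fun i => (B : Matrix (Fin 3) (Fin 3) D.E) i (Fin.last 2)) (fun i => (B : Matrix (Fin 3) (Fin 3) D.E) i (Fin.castSucc j)) = 0 := by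
  rw [← formCongr_apply_eq_hermForm, hB]
  exact finSum_one_apply_last_castSucc Jstar Jperp j

/-- **`orthogonal` in frame currency**: every vector of the line `W = D.E ∙ (B e₃)` (`= V⋆^⊥`) is `H^{τ₁}`-orthogonal to the image
`M(ℂ²) = V⋆ ⊗ ℂ` — the `orthogonal` clause of `IsCompatibleSpecialSource D (D.E ∙ (B e₃)) D₁ φ M` verbatim.
[cite: BergeronMillsonMoeglin2016Balls, Part 2 §3.1] [cite: Liu2021, proof of Thm. 4.15 l. 2207] -/
theorem hermForm_map_span_lastCol_embMatrix_mulVec (hB : formCongr (conjRingHom D.E) B D.H = finSum 2 1 Jstar Jperp) :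
    ∀ w ∈ (D.E ∙ fun i => (B : Matrix (Fin 3) (Fin 3) D.E) i (Fin.last 2)), ∀ v : Fin 2 → ℂ,
      Literature.AlgebraicGeometry.ShimuraVarieties.hermForm (starRingEnd ℂ) (D.H.map D.E.subtype) (fun i => (w i : ℂ))
        ((((B : Matrix (Fin 3) (Fin 3) D.E).submatrix id Fin.castSucc).map D.E.subtype).mulVec v) = 0 := by
  intro w hw v
  obtain ⟨c, rfl⟩ := Submodule.mem_span_singleton.1 hw
  have h0 := hermForm_map_mulVec_eq_zero_of_forall_hermForm_eq_zero (σ := conjRingHom D.E) D.E.subtype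
    (embedding_conjRingHom D.E D.E.subtype) (D.hermForm_lastCol_castSuccCol_eq_zero B Jstar Jperp hB) v
  have hc : (fun i => ((c • fun i => (B : Matrix (Fin 3) (Fin 3) D.E) i (Fin.last 2)) i : ℂ)) =
      (D.E.subtype c) • (⇑D.E.subtype ∘ fun i => (B : Matrix (Fin 3) (Fin 3) D.E) i (Fin.last 2)) := by
    funext i
    simp [Pi.smul_apply, smul_eq_mul]
  rw [hc]
  change UnitaryGroup.hermForm (starRingEnd ℂ) _ _ _ = 0
  rw [UnitaryGroup.hermForm_smul_left_eq]
  change starRingEnd ℂ _ * Literature.AlgebraicGeometry.ShimuraVarieties.hermForm (starRingEnd ℂ) _ _ _ = 0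
  rw [h0, mul_zero]

/-! ### §3 `group` in matrix form -/

/-- **`group` in MATRIX form, frame currency**: for every `γ₁ ∈ M₂(D.E)` the conjugate `γ = B·(γ₁ ⊕ᶠ 1)·B⁻¹` restricts to `γ₁` along
`M`: `γ^{τ₁}·M = M·γ₁^{τ₁}` (vector form = ★ (G2) `conj_finSum_one_right_mulVec_frameEmb_zero`, matrix form by `Matrix.toLin'`
extensionality, then `map D.E.subtype`).  With `γ ∈ D.Γ` — the consumer's choice `Γ₁ = {γ₁ | B(γ₁ ⊕ᶠ 1)B⁻¹ ∈ D.Γ}` — this is the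
`group` clause. [cite: Kudla1984, §1] [cite: Liu2021, proof of Thm. 4.15 l. 2207] -/
theorem map_conj_finSum_one_mul_embMatrix (γ₁ : Matrix (Fin 2) (Fin 2) D.E) :
    (((B : Matrix (Fin 3) (Fin 3) D.E) * finSum 2 1 γ₁ 1 * ((B⁻¹ : GL (Fin 3) D.E) : Matrix (Fin 3) (Fin 3) D.E)).map D.E.subtype) *
        ((B : Matrix (Fin 3) (Fin 3) D.E).submatrix id Fin.castSucc).map D.E.subtype =
      ((B : Matrix (Fin 3) (Fin 3) D.E).submatrix id Fin.castSucc).map D.E.subtype * γ₁.map D.E.subtype := by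
  have hE : ((B : Matrix (Fin 3) (Fin 3) D.E) * finSum 2 1 γ₁ 1 * ((B⁻¹ : GL (Fin 3) D.E) : Matrix (Fin 3) (Fin 3) D.E)) *
      (B : Matrix (Fin 3) (Fin 3) D.E).submatrix id Fin.castSucc =
        (B : Matrix (Fin 3) (Fin 3) D.E).submatrix id Fin.castSucc * γ₁ := by
    refine Matrix.toLin'.injective (LinearMap.ext fun x => ?_)
    rw [Matrix.toLin'_apply, Matrix.toLin'_apply]
    conv_lhs => rw [← Matrix.mulVec_mulVec, submatrix_castSucc_mulVec]
    conv_rhs => rw [← Matrix.mulVec_mulVec, submatrix_castSucc_mulVec]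
    exact conj_finSum_one_right_mulVec_frameEmb_zero (N₁ := 2) (N₂ := 1) B γ₁ x
  have h := congrArg (fun A : Matrix (Fin 3) (Fin 2) D.E => A.map D.E.subtype) hE
  simpa only [Matrix.map_mul, Matrix.submatrix_map] using h

/-! ### §4 The frame of a totally positive line of the datum -/

/-- **The frame of a totally positive definite line of the datum exists** (★ F3 at `σ = conjRingHom D.E`, an involution, and the
datum's hermitian `D.H`): for the `W` of ★ `MR92Prop6Source` (`IsTotallyPositive σ D.H W`, `finrank W = 1`) there are `J⋆, J⊥, B` with
`ᵗσ(B)·H·B = J⋆ ⊕ᶠ J⊥`, `J⊥₀₀` totally positive, `W = D.E ∙ (B e₃)`, the first two columns `H`-orthogonal to `W` and spanning `W^⊥`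
— so `(B, J⋆, M)` and clauses §1–§3 of a compatible special source come from `W` alone.
[cite: BergeronMillsonMoeglin2016Balls, Part 2 §3.1] [cite: Milne2005ShimuraVarieties, Def. 12.5 and Rem. 12.6 p. 113] -/
theorem exists_frame_of_isTotallyPositive_line (W : Submodule D.E (Fin 3 → D.E))
    (hW : IsTotallyPositive (conjRingHom D.E) D.H W) (h1 : Module.finrank D.E W = 1) :
    ∃ (Jstar : Matrix (Fin 2) (Fin 2) D.E) (Jperp : Matrix (Fin 1) (Fin 1) D.E) (B : GL (Fin 3) D.E),
      formCongr (conjRingHom D.E) B D.H = finSum 2 1 Jstar Jperp ∧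
      (∀ τ : D.E →+* ℂ, 0 < (τ (Jperp 0 0)).re) ∧
      Submodule.span D.E {fun i => (B : Matrix (Fin 3) (Fin 3) D.E) i (Fin.last 2)} = W ∧
      (∀ v ∈ W, ∀ j : Fin 2,
        Literature.AlgebraicGeometry.ShimuraVarieties.hermForm (conjRingHom D.E) D.H v
          (fun i => (B : Matrix (Fin 3) (Fin 3) D.E) i (Fin.castSucc j)) = 0) ∧
      ∀ v : Fin 3 → D.E, (∀ u ∈ W, Literature.AlgebraicGeometry.ShimuraVarieties.hermForm (conjRingHom D.E) D.H u v = 0) →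
        v ∈ Submodule.span D.E (Set.range fun j : Fin 2 => fun i => (B : Matrix (Fin 3) (Fin 3) D.E) i (Fin.castSucc j)) :=
  exists_frame_formCongr_eq_finSum_of_isTotallyPositive_of_isHermitian (conjRingHom D.E) D.H
    (fun x => by simp [conjRingHom_apply]) D.conj_H_apply W hW h1

end UnitaryBallUniformisationDatum

end Literature.AlgebraicGeometry.ShimuraVarieties

end
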